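import Summits.ResolutionOfSingularities.ResolutionOfSingularities.Theorems.RadicialJungCleanModelsSufficeChartsKN
import Summits.ResolutionOfSingularities.ResolutionOfSingularities.Theorems.RadicialJungCleanModelsSufficeKummerOrderNotRegular
import Literature.AlgebraicGeometry.Resolution.RsopLocalization

/-!
# Route `RadicialJung`, crux `CleanModelsSuffice`, line `Sketch`: the THRESHOLD lemma at a
# generisation — two charged coordinates in `𝔮` ⇒ the normalisation is NOT regular at `η_𝔮`

Helper for the registered stub `stub_gameCentre1` (phase-1 centre of the exceptionalisation game)
of the skeleton of
`Summit.ResolutionOfSingularities.ResolutionOfSingularities.Theses.RadicialJung.CleanModelsSuffice`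
(stmt-ResolutionOfSingularities-15883). Ring-level form of step (B ⟸) of the intrinsic count of
charged components: with the clean data `(u, a, w, y)` of a game state at `v` (`A = 𝒪_{V,v}`,
radicand `θ = w ∏ uᵢ^{aᵢ}`, `y^p = θ`, `y ∉ K`) and `O = A_𝔮` the local ring of a generisation, if
two distinct CHARGED coordinates `u_{i₁}, u_{i₂}` lie in `𝔮` then `integralClosure O L` is not a
regular local ring. Proof: localise the data at `𝔮` — the charged coordinates are indexed by
`Fin (n+1)` with `u_{i₁}` first, the unit `w` is absorbed into the first charged coordinate
(`w ∏ u^a · (w^s)^p = (w^b u_{i₁})^{a_{i₁}} ∏_{others}`, `a_{i₁} b = p s + 1`), the exponents are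
normalised (`stub_normalizeExponents`), the charged coordinates in `𝔮` are jointly part of a
regular system of parameters of `O` (`IsRsopPart.comp_map_of_le_prime`); then the Kummer order is
the integral closure (`kummerNormal`, `stub_kummerOrderStructure`,
`adjoin_eq_integralClosure_of_isIntegrallyClosed`) and is not regular (`stub_kummerOrderNotRegular`).
-/

noncomputable section

set_option linter.dupNamespace false -- mandated namespace of this single-conjunct summit

open IsLocalRing
open Literature.AlgebraicGeometry.Resolution

namespace Summit.ResolutionOfSingularities.ResolutionOfSingularities.Theorems.RadicialJung.CleanModelsSuffice

/-- Reindexing a product over the charged coordinates: for an equivalence `e : Fin (n+1) ≃ C`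
onto the finset `C = {i | a i ≠ 0}`, `∏_{j} u_{e j}^{a_{e j}} = ∏ᵢ uᵢ^{aᵢ}`. [folklore] -/
theorem prod_charged_reindex {M : Type} [CommMonoid M] {d n : ℕ} (u : Fin d → M) (a : Fin d → ℕ)
    (C : Finset (Fin d)) (hC : ∀ i, i ∈ C ↔ a i ≠ 0) (e : Fin (n + 1) ≃ {i // i ∈ C}) :
    ∏ j, u (e j).1 ^ a (e j).1 = ∏ i, u i ^ a i := by
  classical
  have h1 : ∏ j, u (e j).1 ^ a (e j).1 = ∏ x : {i // i ∈ C}, u x.1 ^ a x.1 :=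
    Fintype.prod_equiv e _ _ fun _ => rfl
  rw [h1, Finset.prod_coe_sort C fun i => u i ^ a i, ← Finset.prod_filter_mul_prod_filter_not
    Finset.univ (fun i => i ∈ C)]
  have h2 : Finset.univ.filter (fun i : Fin d => i ∈ C) = C := by
    ext i; simp
  have h3 : ∏ i ∈ Finset.univ.filter (fun i : Fin d => ¬ i ∈ C), u i ^ a i = 1 := by
    refine Finset.prod_eq_one fun i hi => ?_
    rw [Finset.mem_filter, hC, not_not] at hi
    rw [hi.2, pow_zero]
  rw [h2, h3, mul_one]

/-- **Threshold lemma, `⟸` direction: two charged coordinates in `𝔮` ⇒ the integral closure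
of `O = A_𝔮` in `L` is not a regular local ring.** Setting as in
`isRegularLocalRing_integralClosure_of_charged_le_one` (`A` regular local, `u` a regular system
of parameters, exponents `aᵢ ∈ {0} ∪ (ℕ ∖ pℕ)`, `w ∈ Aˣ`, `O` a localisation at the prime `𝔮`
with fraction field `K` of characteristic `p`, `[L : K] = p`, `y ∈ L ∖ K`, `y^p = w ∏ uᵢ^{aᵢ}`);
if `a_{i₁}, a_{i₂} ≠ 0` for `i₁ ≠ i₂` with `u_{i₁}, u_{i₂} ∈ 𝔮`, then `integralClosure O L` is
NOT regular: it is the Kummer order of the localised, normalised data (`kummerNormal`), which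
has two non-unit charged coordinates (`stub_kummerOrderNotRegular`). [folklore] -/
theorem not_isRegularLocalRing_integralClosure_of_two_le_charged
    {A O K L : Type} [CommRing A] [IsRegularLocalRing A] [CommRing O] [Algebra A O]
    (q : Ideal A) [q.IsPrime] [IsLocalization.AtPrime O q] [IsLocalRing O]
    [Field K] [Algebra O K] [IsFractionRing O K] [Algebra A K] [IsScalarTower A O K]
    [Field L] [Algebra K L] [Algebra O L] [IsScalarTower O K L] [Algebra A L] [IsScalarTower A O L]
    (p : ℕ) (hp : p.Prime) [CharP K p] (hdeg : Module.finrank K L = p)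
    {d : ℕ} (u : Fin d → A) (hd : (maximalIdeal A).spanFinrank = d)
    (hu : Ideal.span (Set.range u) = maximalIdeal A) (a : Fin d → ℕ)
    (ha : ∀ i, a i = 0 ∨ ¬ p ∣ a i) (w : A) (hw : IsUnit w) (y : L)
    (hy : y ∉ Set.range (algebraMap K L)) (hyp : y ^ p = algebraMap A L (w * ∏ i, u i ^ a i))
    {i₁ i₂ : Fin d} (hne : i₁ ≠ i₂) (ha₁ : a i₁ ≠ 0) (ha₂ : a i₂ ≠ 0) (hq₁ : u i₁ ∈ q)
    (hq₂ : u i₂ ∈ q) : ¬ IsRegularLocalRing (integralClosure O L) := by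
  classical
  haveI : Fact p.Prime := ⟨hp⟩
  haveI : IsDomain A := isDomain_of_isRegularLocalRing A
  haveI : IsDomain O := IsLocalization.isDomain_of_le_nonZeroDivisors O q.primeCompl_le_nonZeroDivisors
  have hinjAO : Function.Injective (algebraMap A O) :=
    IsLocalization.injective O q.primeCompl_le_nonZeroDivisors
  have hinjOL : Function.Injective (algebraMap O L) := by
    rw [IsScalarTower.algebraMap_eq O K L]
    exact (algebraMap K L).injective.comp (IsFractionRing.injective O K)
  haveI := isRegularLocalRing_localization_atPrime A q
  haveI : IsRegularLocalRing O := IsRegularLocalRing.of_ringEquiv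
    (IsLocalization.algEquiv q.primeCompl (Localization.AtPrime q) O).toRingEquiv
  haveI : FiniteDimensional K L := Module.finite_of_finrank_pos (by rw [hdeg]; exact hp.pos)
  have hrsop : IsRsopPart u := by
    have h := isRsopPart_comp_of_rsop hd u hu id Function.injective_id
    rwa [Function.comp_id] at h
  have hmemO : ∀ x : A, algebraMap A O x ∈ maximalIdeal O ↔ x ∈ q := fun x =>
    IsLocalization.AtPrime.to_map_mem_maximal_iff O q x
  /- (1) the charged index set, enumerated with `i₁` first -/
  set C : Finset (Fin d) := Finset.univ.filter fun i => a i ≠ 0 with hC_def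
  have hC : ∀ i, i ∈ C ↔ a i ≠ 0 := fun i => by simp [hC_def]
  have hi₁C : i₁ ∈ C := (hC i₁).mpr ha₁
  have hi₂C : i₂ ∈ C := (hC i₂).mpr ha₂
  obtain ⟨n, hn⟩ : ∃ n, Fintype.card {i // i ∈ C} = n + 1 :=
    ⟨Fintype.card {i // i ∈ C} - 1, (Nat.succ_pred_eq_of_pos
      (Fintype.card_pos_iff.mpr ⟨⟨i₁, hi₁C⟩⟩)).symm⟩
  let e₀ : Fin (n + 1) ≃ {i // i ∈ C} := (Fintype.equivFinOfCardEq hn).symm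
  let e : Fin (n + 1) ≃ {i // i ∈ C} := (Equiv.swap 0 (e₀.symm ⟨i₁, hi₁C⟩)).trans e₀
  have he0 : (e 0).1 = i₁ := by
    simp [e, Equiv.swap_apply_left]
  let idx : Fin (n + 1) → Fin d := fun j => (e j).1
  have hidx_inj : Function.Injective idx := fun j j' h =>
    e.injective (Subtype.ext h)
  have hidx0 : idx 0 = i₁ := he0
  have haidx : ∀ j, ¬ p ∣ a (idx j) := fun j =>
    (ha (idx j)).resolve_left ((hC _).mp (e j).2)
  /- (2) exponent arithmetic `a i₁ * b = p * s + 1` -/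
  have hcop : Nat.Coprime (a i₁) p :=
    ((Nat.Prime.coprime_iff_not_dvd hp).mpr ((ha i₁).resolve_left ha₁)).symm
  obtain ⟨b, -, hb⟩ := Nat.exists_mul_mod_eq_one_of_coprime hcop hp.one_lt
  obtain ⟨s, hs⟩ : ∃ s : ℕ, a i₁ * b = p * s + 1 :=
    ⟨a i₁ * b / p, by have h := Nat.div_add_mod (a i₁ * b) p; rw [hb] at h; exact h.symm⟩
  /- (3) the localised coordinates `t` (the unit absorbed into the first one) -/
  let t : Fin (n + 1) → O :=
    Fin.cons (algebraMap A O (w ^ b * u i₁)) fun j => algebraMap A O (u (idx j.succ))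
  have ht0 : t 0 = algebraMap A O (w ^ b * u i₁) := rfl
  have htsucc : ∀ j : Fin n, t j.succ = algebraMap A O (u (idx j.succ)) := fun j => rfl
  have ht : ∀ j, t j ≠ 0 := by
    refine Fin.cases ?_ (fun j => ?_)
    · rw [ht0, map_ne_zero_iff _ hinjAO]
      exact mul_ne_zero (hw.pow b).ne_zero (hrsop.ne_zero i₁)
    · rw [htsucc, map_ne_zero_iff _ hinjAO]
      exact hrsop.ne_zero _
  have htmem : ∀ j, t j ∈ maximalIdeal O ↔ u (idx j) ∈ q := by
    refine Fin.cases ?_ (fun j => ?_)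
    · rw [ht0, hmemO, hidx0]
      exact Ideal.unit_mul_mem_iff_mem q (hw.pow b)
    · rw [htsucc, hmemO]
  let α : Fin (n + 1) → ℕ := fun j => a (idx j)
  /- (4) the twisted generator `y₁ = y · w^s` and its radicand `∏ t^α` -/
  set y₁ : L := y * algebraMap A L (w ^ s) with hy₁_def
  have hwL : algebraMap A L (w ^ s) ≠ 0 := by
    rw [IsScalarTower.algebraMap_apply A O L, map_ne_zero_iff _ hinjOL, map_ne_zero_iff _ hinjAO]
    exact (hw.pow s).ne_zero
  have hy₁ : y₁ ∉ Set.range (algebraMap K L) := by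
    rintro ⟨c, hc⟩
    refine hy ⟨c / algebraMap O K (algebraMap A O (w ^ s)), ?_⟩
    rw [map_div₀, hc, ← IsScalarTower.algebraMap_apply, ← IsScalarTower.algebraMap_apply, hy₁_def,
      mul_div_cancel_right₀ _ hwL]
  have hprodA : ∏ j, t j ^ α j = algebraMap A O (w ^ (p * s + 1) * ∏ i, u i ^ a i) := by
    rw [Fin.prod_univ_succ, ht0]
    simp only [htsucc]
    rw [← prod_charged_reindex u a C hC e, Fin.prod_univ_succ]
    change algebraMap A O (w ^ b * u i₁) ^ a (idx 0) * ∏ j : Fin n, algebraMap A O (u (idx j.succ)) ^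
      a (idx j.succ) = algebraMap A O (w ^ (p * s + 1) * (u (idx 0) ^ a (idx 0) *
        ∏ j : Fin n, u (idx j.succ) ^ a (idx j.succ)))
    rw [hidx0, ← hs]
    simp only [← map_pow, ← map_prod, ← map_mul]
    congr 1
    ring
  have hyp₁ : y₁ ^ p = algebraMap O L (∏ j, t j ^ α j) := by
    rw [hprodA, ← IsScalarTower.algebraMap_apply, hy₁_def, mul_pow, hyp, ← map_pow, ← map_mul]
    congr 1
    ring
  /- (5) normalise the exponents -/
  obtain ⟨y', a', -, hy', ha'0, ha', -, -, hyp'⟩ :=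
    stub_normalizeExponents (K := K) p hp hdeg n t ht α haidx y₁ hy₁ hyp₁
  /- (6) the charged coordinates in `𝔮` are jointly part of a regular system of parameters -/
  have hSne : ∃ j, t j ∈ maximalIdeal O := ⟨0, (htmem 0).mpr (hidx0 ▸ hq₁)⟩
  have hsop : ∃ (dw : ℕ) (tw : Fin dw → O) (ι : Fin (n + 1) → Fin dw),
      Ideal.span (Set.range tw) = maximalIdeal O ∧ ringKrullDim O = (dw : WithBot ℕ∞) ∧
      (∀ j, t j ∈ maximalIdeal O → tw (ι j) = t j) ∧
      (∀ j j', t j ∈ maximalIdeal O → t j' ∈ maximalIdeal O → ι j = ι j' → j = j') := by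
    set J : Finset (Fin (n + 1)) := Finset.univ.filter fun j => u (idx j) ∈ q with hJ_def
    have hJ : ∀ j, j ∈ J ↔ u (idx j) ∈ q := fun j => by simp [hJ_def]
    have h0J : (0 : Fin (n + 1)) ∈ J := (hJ 0).mpr (hidx0 ▸ hq₁)
    let r := Fintype.card {j // j ∈ J}
    let σ : Fin r ≃ {j // j ∈ J} := (Fintype.equivFinOfCardEq rfl).symm
    have hz₀ : IsRsopPart fun l : Fin r => algebraMap A O (u (idx (σ l).1)) :=
      hrsop.comp_map_of_le_prime (fun l => idx (σ l).1)
        (fun l l' h => σ.injective (Subtype.ext (hidx_inj h))) q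
        (fun l => (hJ _).mp (σ l).2) O
    have hz : IsRsopPart fun l : Fin r => t (σ l).1 := by
      refine hz₀.of_associated fun l => ?_
      rcases Fin.eq_zero_or_eq_succ (σ l).1 with h | ⟨j, h⟩
      · rw [h, ht0, hidx0, map_mul]
        exact (associated_unit_mul_left _ _ ((hw.pow b).map _)).symm
      · rw [h, htsucc]
    obtain ⟨e', x, hxrank, hxspan, hxz⟩ := hz.exists_rsop
    refine ⟨r + e', x, fun j => if h : u (idx j) ∈ q then Fin.castAdd e' (σ.symm ⟨j, (hJ j).mpr h⟩)
      else Fin.castAdd e' (σ.symm ⟨0, h0J⟩), hxspan, ?_, fun j hj => ?_, fun j j' hj hj' hjj' => ?_⟩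
    · have h := IsRegularLocalRing.spanFinrank_maximalIdeal (R := O)
      rw [hxrank] at h
      exact_mod_cast h.symm
    · rw [htmem] at hj
      simp only [dif_pos hj, hxz, Equiv.apply_symm_apply]
    · rw [htmem] at hj hj'
      simp only [dif_pos hj, dif_pos hj'] at hjj'
      have := σ.symm.injective (Fin.castAdd_injective _ _ hjj')
      exact congrArg Subtype.val this
  /- (7) the Kummer order is the integral closure and is not regular -/
  let z : Fin p → L := fun j => y' ^ (j : ℕ) / algebraMap O L (∏ i, t i ^ ((j : ℕ) * a' i / p))
  have hIC : IsIntegrallyClosed (Algebra.adjoin O (Set.range z)) :=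
    kummerNormal p hp hdeg n t ht a' ha'0 ha' y' hy' hyp' hSne hsop
  obtain ⟨-, -, hfin, hloc, hfrac⟩ :=
    stub_kummerOrderStructure p hp hdeg n t ht a' ha'0 ha' y' hy' hyp' z (fun _ => rfl)
  haveI := hfin
  haveI := hloc
  haveI := hfrac
  haveI := hIC
  haveI : Algebra.IsIntegral O (Algebra.adjoin O (Set.range z)) := inferInstance
  have heq : Algebra.adjoin O (Set.range z) = integralClosure O L :=
    adjoin_eq_integralClosure_of_isIntegrallyClosed _
  have h0 : t 0 ∈ maximalIdeal O := (htmem 0).mpr (hidx0 ▸ hq₁)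
  have h1 : ∃ j : Fin (n + 1), j ≠ 0 ∧ t j ∈ maximalIdeal O := by
    refine ⟨e.symm ⟨i₂, hi₂C⟩, fun h => hne ?_, ?_⟩
    · have := congrArg (fun j => (e j).1) h
      simp only [Equiv.apply_symm_apply] at this
      rw [this]
      exact hidx0.symm
    · rw [htmem]
      change u (e (e.symm ⟨i₂, hi₂C⟩)).1 ∈ q
      rw [Equiv.apply_symm_apply]
      exact hq₂
  have hnot := stub_kummerOrderNotRegular p hp hdeg n t ht a' ha'0 ha' y' hy' hyp' z (fun _ => rfl)
    h0 h1
  intro hreg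
  haveI := hreg
  exact hnot (IsRegularLocalRing.of_ringEquiv (Subalgebra.equivOfEq _ _ heq).toRingEquiv.symm)

end Summit.ResolutionOfSingularities.ResolutionOfSingularities.Theorems.RadicialJung.CleanModelsSuffice

end
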